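import Literature.Barriers.RiemannHypothesis.EpsteinZetaConstantTerms
import Literature.NumberTheory.LFunctions.RiemannXiShiftInequality
import Literature.Analysis.SpecialFunctions.GammaStirlingOrder
import HarnessLib

/-!
# Stark's theorem on the zeros of Epstein zeta functions, I: the objects `f`, `P_z`, `M_z` and the domination `|f(1−s)| < |f(s)|`

Fourth proof file next to `Literature/Barriers/RiemannHypothesis/EpsteinZetaRealZeros.lean`
(barrier `EpsteinZetaRealZeros = BatemanGrosswald1964_realZero ∧ Stark1967_thm1`), preparing the
proof of `Stark1967_thm1` (H. M. Stark, *On the zeros of Epstein's zeta function*, Mathematika 14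
(1967) 47–55, Theorem 1: for `k > K` every zero of `ζ(s, Q)` with `−1 < σ < 2`, `|t| ≤ 2k` is
simple, and all but two real ones lie on `σ = ½`). In Stark's notation ((10)–(11)) the completed
function is `α(s) = f(s) + f(1−s) + g(s)`, `f(s) = (k/π)^s Γ(s) ζ(2s)`. With the tree's
`Λ_z = (thetaFEPair z).Λ` for `z = x + ik` (`Literature.NumberTheory.Automorphic.thetaFEPair`) and
the decomposition of `EpsteinZetaConstantTerms.lean`, `Λ_z = 2f(s) + 2f(1−s) + E_z(s)` where

* `Literature.Barriers.RiemannHypothesis.starkF` — `f(s) = k^s Λ(2s)` (`Λ = completedRiemannZeta`,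
  `= π^{-s}Γ(s)ζ(2s)`), exactly Stark's `f`;
* `Literature.Barriers.RiemannHypothesis.epsteinP` — the entire function `P_z(s) = s(s−1)Λ_z(s)`
  (`= s(s−1)Λ₀ + 1`), whose zeros are the zeros of `ζ(s, Q)` off `s = 0`;
* `Literature.Barriers.RiemannHypothesis.epsteinMain` — the entire "main part"
  `M_z(s) = P_z(s) − s(s−1)E_z(s) = s(s−1)(2f(s) + 2f(1−s))` (`= 2(s−1)k^sξ(2s)/(2s−1)·(…)`;
  Lagarias–Suzuki's `2H(k, s)/(2s−1)`).

Proved here: entirety, the functional equations `P_z(1−s) = P_z(s)`, `M_z(1−s) = M_z(s)`, the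
reflection symmetries `P_z(s̄) = conj P_z(s)` etc. (so both are real on the real axis and on the
critical line), and **the domination `‖f(1−s)‖ ≤ k^{1−2σ} (|s|/|s−1|) ‖f(s)‖` for `σ > ½`**
(`Literature.Barriers.RiemannHypothesis.norm_starkF_one_sub_le`), from Lagarias–Suzuki's shift
inequality `Literature.NumberTheory.LFunctions.norm_completedRiemannZeta_shift_le`. This replaces
Stark's Lemmas 1, 2, 4 (which use the Vinogradov zero-free region to the left of `σ = 1`):
`f(1−s)` is smaller than `f(s)` at EVERY point with `σ > ½`, not only outside
`|σ − ½| ≤ (log k)^{−7/8}`.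

## References

* [Stark1967EpsteinZeros] H. M. Stark, Mathematika 14 (1967) 47–55, §2 (9)–(13), §3 Lemmas 1–5.
* [LagariasSuzuki2006] J. C. Lagarias, M. Suzuki, J. Number Theory 118 (2006), Theorem 2.1, §3.
* [BatemanGrosswald1964] Acta Arith. 9 (1964), Theorem 1.
-/

noncomputable section

open Complex Filter Topology MeasureTheory Set HurwitzZeta Asymptotics

open scoped UpperHalfPlane Real ComplexConjugate

namespace Literature.Barriers.RiemannHypothesis

open Literature.NumberTheory.Automorphic
open Literature.NumberTheory.LFunctions

/-! ## Conjugation and Mellin transforms of real kernels -/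

/-- The Mellin transform of a conjugation-invariant kernel commutes with conjugation:
`(Mf)(s̄) = conj (Mf)(s)`. [folklore] -/
theorem mellin_conj {f : ℝ → ℂ} (hf : ∀ t, conj (f t) = f t) (s : ℂ) :
    mellin f (conj s) = conj (mellin f s) := by
  rw [mellin, mellin, ← integral_conj]
  refine setIntegral_congr_fun measurableSet_Ioi fun t ht ↦ ?_
  have ht0 : 0 < t := ht
  simp only [smul_eq_mul, map_mul, hf t]
  congr 1
  have harg : ((t : ℂ)).arg ≠ π := by
    rw [Complex.arg_ofReal_of_nonneg ht0.le]; exact Real.pi_ne_zero.symm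
  have h := Complex.conj_cpow (t : ℂ) (conj s - 1) harg
  rw [Complex.conj_ofReal] at h
  rw [h, map_sub, map_one, Complex.conj_conj]

/-- The theta kernel `f_modif` of `Θ_z` is real. [folklore] -/
theorem conj_f_modif_thetaFEPair (z : ℍ) (t : ℝ) :
    conj ((thetaFEPair z).f_modif t) = (thetaFEPair z).f_modif t := by
  rw [f_modif_thetaFEPair]
  simp only [map_add, Set.indicator_apply]
  split_ifs <;> simp

/-- `Λ₀,z(s̄) = conj Λ₀,z(s)` (the theta series is real). [folklore] -/
theorem thetaFEPair_Λ₀_conj (z : ℍ) (s : ℂ) :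
    (thetaFEPair z).Λ₀ (conj s) = conj ((thetaFEPair z).Λ₀ s) :=
  mellin_conj (conj_f_modif_thetaFEPair z) s

/-- `Λ₀,z(1 − s) = Λ₀,z(s)` (self-duality of the theta pair). [folklore] -/
theorem thetaFEPair_Λ₀_one_sub (z : ℍ) (s : ℂ) :
    (thetaFEPair z).Λ₀ (1 - s) = (thetaFEPair z).Λ₀ s := by
  have h := (thetaFEPair z).functional_equation₀ s
  rw [thetaFEPair_symm] at h
  simpa [thetaFEPair] using h

/-- The remainder `R_z` is real. [folklore] -/
theorem conj_thetaRemainder (z : ℍ) (t : ℝ) : conj (thetaRemainder z t) = thetaRemainder z t := by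
  rw [thetaRemainder_def]; simp

/-- The truncated remainder is real. [folklore] -/
theorem conj_thetaRemainderTop (z : ℍ) (t : ℝ) :
    conj (thetaRemainderTop z t) = thetaRemainderTop z t := by
  unfold thetaRemainderTop
  by_cases h : t ∈ Ioi (1 : ℝ)
  · rw [Set.indicator_of_mem h]; exact conj_thetaRemainder z t
  · rw [Set.indicator_of_notMem h]; simp

/-- `E_z(s̄) = conj E_z(s)`. [folklore] -/
theorem epsteinBesselPart_conj (z : ℍ) (s : ℂ) :
    epsteinBesselPart z (conj s) = conj (epsteinBesselPart z s) := by
  unfold epsteinBesselPart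
  rw [map_add, ← mellin_conj (conj_thetaRemainderTop z), ← mellin_conj (conj_thetaRemainderTop z),
    map_sub, map_one]

/-- `Λ(s̄) = conj Λ(s)` for Mathlib's completed Riemann zeta function. [folklore] -/
theorem completedRiemannZeta_conj' (s : ℂ) :
    completedRiemannZeta (conj s) = conj (completedRiemannZeta s) := by
  rw [completedRiemannZeta_eq, completedRiemannZeta_eq, completedRiemannZeta₀_conj]
  simp only [map_sub, map_div₀, map_one]

/-! ## Stark's `f(s) = k^s Λ(2s)` -/

/-- **Stark's `f`**: `f(s) = k^s Λ(2s) = (k/π)^s Γ(s) ζ(2s)`, `k = Im z`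
(Stark (10): `f(s) = ζ(2s) b(s)`, `b(s) = (k/π)^s Γ(s)`). [cite: Stark1967EpsteinZeros, §2 (10)] -/
def starkF (z : ℍ) (s : ℂ) : ℂ :=
  ((z.im : ℝ) : ℂ) ^ s * completedRiemannZeta (2 * s)

/-- Unfolding. [cite: Stark1967EpsteinZeros, §2 (10)] -/
theorem starkF_def (z : ℍ) (s : ℂ) :
    starkF z s = ((z.im : ℝ) : ℂ) ^ s * completedRiemannZeta (2 * s) := rfl

/-- `f(s̄) = conj f(s)`. [folklore] -/
theorem starkF_conj (z : ℍ) (s : ℂ) : starkF z (conj s) = conj (starkF z s) := by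
  have hy := z.im_pos
  rw [starkF_def, starkF_def, map_mul, ← completedRiemannZeta_conj', map_mul, map_ofNat]
  congr 1
  have harg : (((z.im : ℝ) : ℂ)).arg ≠ π := by
    rw [Complex.arg_ofReal_of_nonneg hy.le]; exact Real.pi_ne_zero.symm
  rw [Complex.cpow_conj _ _ harg, Complex.conj_ofReal]

/-- `f(1 − s) = k^{1−s} Λ(2s − 1)` (functional equation of `Λ`). [folklore] -/
theorem starkF_one_sub (z : ℍ) (s : ℂ) :
    starkF z (1 - s) = ((z.im : ℝ) : ℂ) ^ (1 - s) * completedRiemannZeta (2 * s - 1) := by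
  rw [starkF_def, ← completedRiemannZeta_one_sub (2 * s - 1)]
  congr 2; ring

/-- Differentiability of `f` away from `s = 0, ½`. [folklore] -/
theorem differentiableAt_starkF (z : ℍ) {s : ℂ} (h0 : s ≠ 0) (hh : s ≠ 1 / 2) :
    DifferentiableAt ℂ (starkF z) s := by
  have hy := z.im_pos
  have hyc : ((z.im : ℝ) : ℂ) ≠ 0 := by exact_mod_cast hy.ne'
  have h2 : 2 * s ≠ 0 := mul_ne_zero two_ne_zero h0
  have h2' : 2 * s ≠ 1 := fun h ↦ hh (by linear_combination h / 2)
  unfold starkF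
  exact (differentiableAt_id.const_cpow (Or.inl hyc)).mul
    ((differentiableAt_completedZeta h2 h2').comp s (differentiableAt_id.const_mul _))

/-- `f` as a product for `Re s > 0`: `f(s) = k^s π^{−s} Γ(s) ζ(2s)`. [cite: Stark1967EpsteinZeros, §2 (10)] -/
theorem starkF_eq_Gamma_mul (z : ℍ) {s : ℂ} (hs : 0 < s.re) :
    starkF z s = ((z.im : ℝ) : ℂ) ^ s * ((π : ℂ) ^ (-s) * Complex.Gamma s * riemannZeta (2 * s)) := by
  have h2 : 2 * s ≠ 0 := by
    intro h; have := congrArg Complex.re h; simp at this; linarith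
  have hG : Gammaℝ (2 * s) ≠ 0 := Gammaℝ_ne_zero_of_re_pos (by simp; linarith)
  have hG' : Gammaℝ (2 * s) = (π : ℂ) ^ (-s) * Complex.Gamma s := by
    rw [Gammaℝ_def]
    congr 2
    · ring
    · ring
  rw [starkF_def, riemannZeta_def_of_ne_zero h2]
  rw [hG'] at hG ⊢
  congr 1
  rw [mul_div_cancel₀ _ hG]

/-- The modulus of `f`: `‖f(σ + it)‖ = k^σ π^{−σ} ‖Γ(σ+it)‖ ‖ζ(2σ + 2it)‖` (`σ > 0`). [folklore] -/
theorem norm_starkF_eq (z : ℍ) {s : ℂ} (hs : 0 < s.re) :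
    ‖starkF z s‖ = z.im ^ s.re * (π ^ (-s.re) * ‖Complex.Gamma s‖ * ‖riemannZeta (2 * s)‖) := by
  have hy := z.im_pos
  rw [starkF_eq_Gamma_mul z hs, norm_mul, norm_mul, norm_mul,
    Complex.norm_cpow_eq_rpow_re_of_pos hy, Complex.norm_cpow_eq_rpow_re_of_pos Real.pi_pos,
    Complex.neg_re]

/-- `f(s) ≠ 0` for `Re s ≥ ½`, `s ≠ ½` (`ζ(2s) ≠ 0` on `Re 2s ≥ 1`). [folklore] -/
theorem starkF_ne_zero (z : ℍ) {s : ℂ} (hs : 1 / 2 ≤ s.re) (hh : s ≠ 1 / 2) : starkF z s ≠ 0 := by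
  have hy := z.im_pos
  have hyc : ((z.im : ℝ) : ℂ) ≠ 0 := by exact_mod_cast hy.ne'
  rw [starkF_eq_Gamma_mul z (by linarith)]
  refine mul_ne_zero (Complex.cpow_ne_zero_iff.2 (Or.inl hyc)) (mul_ne_zero (mul_ne_zero ?_ ?_) ?_)
  · exact Complex.cpow_ne_zero_iff.2 (Or.inl (by exact_mod_cast Real.pi_pos.ne'))
  · exact Complex.Gamma_ne_zero_of_re_pos (by linarith)
  · have h2 : 2 * s ≠ 1 := fun h ↦ hh (by linear_combination h / 2)
    exact riemannZeta_ne_zero_of_one_le_re (by simp; linarith)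

/-- **Domination (Lagarias–Suzuki, replacing Stark's Lemmas 1, 2, 4).** For `½ < σ ≤ 5`, `s ≠ 1`:
`‖f(1 − s)‖ ≤ k^{1−2σ} (‖s‖/‖s−1‖) ‖f(s)‖`; in particular `|f(1−s)| < |f(s)|` as soon as
`k^{2σ−1} > |s/(s−1)|`, which on `|t| ≥ 1` holds for every `σ > ½`, `k ≥ 2`.
[cite: LagariasSuzuki2006, Theorem 2.1 and §3] -/
theorem norm_starkF_one_sub_le (z : ℍ) {s : ℂ} (hs : 1 / 2 < s.re) (hs5 : s.re ≤ 5) (h1 : s ≠ 1) :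
    ‖starkF z (1 - s)‖ ≤ z.im ^ (1 - 2 * s.re) * (‖s‖ / ‖s - 1‖) * ‖starkF z s‖ := by
  have hy := z.im_pos
  have hsh := norm_completedRiemannZeta_shift_le hs hs5 h1
  have hs0 : s ≠ 0 := fun h ↦ by rw [h] at hs; simp at hs; linarith
  have hn1 : 0 < ‖s - 1‖ := norm_pos_iff.2 (sub_ne_zero.2 h1)
  rw [norm_mul, norm_mul] at hsh
  rw [starkF_one_sub, starkF_def, norm_mul, norm_mul, Complex.norm_cpow_eq_rpow_re_of_pos hy,
    Complex.norm_cpow_eq_rpow_re_of_pos hy, Complex.sub_re, Complex.one_re]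
  -- `‖Λ(2s−1)‖ ≤ ‖s‖/‖s−1‖ ‖Λ(2s)‖`
  have h2 : ‖completedRiemannZeta (2 * s - 1)‖ ≤ ‖s‖ / ‖s - 1‖ * ‖completedRiemannZeta (2 * s)‖ := by
    rw [div_mul_eq_mul_div, le_div_iff₀ hn1, mul_comm]
    exact hsh
  have e : z.im ^ (1 - 2 * s.re) * (‖s‖ / ‖s - 1‖) * (z.im ^ s.re * ‖completedRiemannZeta (2 * s)‖) =
      z.im ^ (1 - s.re) * (‖s‖ / ‖s - 1‖ * ‖completedRiemannZeta (2 * s)‖) := by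
    have : z.im ^ (1 - 2 * s.re) * z.im ^ s.re = z.im ^ (1 - s.re) := by
      rw [← Real.rpow_add hy]; congr 1; ring
    calc z.im ^ (1 - 2 * s.re) * (‖s‖ / ‖s - 1‖) * (z.im ^ s.re * ‖completedRiemannZeta (2 * s)‖)
        = (z.im ^ (1 - 2 * s.re) * z.im ^ s.re) * (‖s‖ / ‖s - 1‖ * ‖completedRiemannZeta (2 * s)‖) := by
          ring
      _ = _ := by rw [this]
  rw [e]
  exact mul_le_mul_of_nonneg_left h2 (Real.rpow_nonneg hy.le _)

/-! ## The entire function `P_z(s) = s(s−1)Λ_z(s)` -/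

/-- **`P_z(s) = s(s−1)Λ₀,z(s) + 1 = s(s−1)Λ_z(s)`**, entire; its zeros are the zeros of `Λ_z`, i.e. of
`ζ(s, Q)` (`s ≠ 0`; the pole `s = 1` of `ζ_Q` and the pole `s = 0` of `Γ` are removed).
[cite: Stark1967EpsteinZeros, §3 Lemma 5 (proof)] -/
def epsteinP (z : ℍ) (s : ℂ) : ℂ :=
  s * (s - 1) * (thetaFEPair z).Λ₀ s + 1

/-- Unfolding. [folklore] -/
theorem epsteinP_def (z : ℍ) (s : ℂ) : epsteinP z s = s * (s - 1) * (thetaFEPair z).Λ₀ s + 1 := rfl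

/-- `P_z` is entire. [folklore] -/
theorem differentiable_epsteinP (z : ℍ) : Differentiable ℂ (epsteinP z) := by
  unfold epsteinP
  exact ((differentiable_id.mul (differentiable_id.sub_const 1)).mul
    (thetaFEPair z).differentiable_Λ₀).add_const 1

/-- `P_z(s) = s(s−1)Λ_z(s)` for `s ≠ 0, 1`. [folklore] -/
theorem epsteinP_eq_mul_Λ (z : ℍ) {s : ℂ} (h0 : s ≠ 0) (h1 : s ≠ 1) :
    epsteinP z s = s * (s - 1) * (thetaFEPair z).Λ s := by
  rw [epsteinP_def, thetaFEPair_Λ_eq_Λ₀]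
  have h1' : (1 : ℂ) - s ≠ 0 := sub_ne_zero.2 (Ne.symm h1)
  field_simp
  ring

/-- `P_z(0) = 1`. [folklore] -/
theorem epsteinP_zero (z : ℍ) : epsteinP z 0 = 1 := by simp [epsteinP_def]

/-- `P_z(1) = 1`. [folklore] -/
theorem epsteinP_one (z : ℍ) : epsteinP z 1 = 1 := by simp [epsteinP_def]

/-- **Functional equation `P_z(1 − s) = P_z(s)`** (Stark (13): `α(s) = α(1 − s)`).
[cite: Stark1967EpsteinZeros, §2 (13)] -/
theorem epsteinP_one_sub (z : ℍ) (s : ℂ) : epsteinP z (1 - s) = epsteinP z s := by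
  rw [epsteinP_def, epsteinP_def, thetaFEPair_Λ₀_one_sub]; ring

/-- `P_z(s̄) = conj P_z(s)` (the theta series is real). [folklore] -/
theorem epsteinP_conj (z : ℍ) (s : ℂ) : epsteinP z (conj s) = conj (epsteinP z s) := by
  rw [epsteinP_def, epsteinP_def, thetaFEPair_Λ₀_conj]
  simp only [map_add, map_mul, map_sub, map_one]

/-- `P_z` is real on the critical line: `P_z(½ + it) ∈ ℝ` ("both `α(s)` and `g(s)` are real valued on
the line `σ = ½`"). [cite: Stark1967EpsteinZeros, §2 (after (13))] -/
theorem epsteinP_half_add_im (z : ℍ) (t : ℝ) : (epsteinP z (1 / 2 + t * I)).im = 0 := by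
  have h : conj (epsteinP z (1 / 2 + t * I)) = epsteinP z (1 / 2 + t * I) := by
    rw [← epsteinP_conj, ← epsteinP_one_sub]
    congr 1
    apply Complex.ext <;> simp; norm_num
  exact Complex.conj_eq_iff_im.1 h

/-- `P_z` is real on the real axis. [folklore] -/
theorem epsteinP_ofReal_im (z : ℍ) (σ : ℝ) : (epsteinP z σ).im = 0 := by
  have h : conj (epsteinP z σ) = epsteinP z σ := by
    rw [← epsteinP_conj, Complex.conj_ofReal]
  exact Complex.conj_eq_iff_im.1 h

/-- The derivative inherits the functional equation: `P_z'(1 − s) = −P_z'(s)`. [folklore] -/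
theorem deriv_epsteinP_one_sub (z : ℍ) (s : ℂ) : deriv (epsteinP z) (1 - s) = -deriv (epsteinP z) s := by
  have h : (epsteinP z) = fun w ↦ epsteinP z (1 - w) := by
    funext w; rw [epsteinP_one_sub]
  have hd : HasDerivAt (fun w ↦ epsteinP z (1 - w)) (deriv (epsteinP z) (1 - s) * (-1)) s := by
    have h1 : HasDerivAt (fun w : ℂ ↦ 1 - w) (-1) s := (hasDerivAt_id' s).const_sub 1
    exact ((differentiable_epsteinP z) (1 - s)).hasDerivAt.comp s h1
  rw [← h] at hd
  rw [hd.deriv]; ring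

/-- The derivative commutes with conjugation: `P_z'(s̄) = conj P_z'(s)`. [folklore] -/
theorem deriv_epsteinP_conj (z : ℍ) (s : ℂ) :
    deriv (epsteinP z) (conj s) = conj (deriv (epsteinP z) s) := by
  have hfun : (conj ∘ epsteinP z ∘ conj : ℂ → ℂ) = epsteinP z := by
    funext w; simp [Function.comp_apply, epsteinP_conj]
  have h : deriv (conj ∘ epsteinP z ∘ conj : ℂ → ℂ) = conj ∘ deriv (epsteinP z) ∘ conj :=
    deriv_conj_conj
  rw [hfun] at h
  have h' := congrFun h (conj s)
  simpa using h'

/-! ## The main part `M_z(s) = s(s−1)(2f(s) + 2f(1−s))` -/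

/-- **The main part** `M_z(s) = P_z(s) − s(s−1)E_z(s)`, entire; off `{0, ½, 1}` it equals
`s(s−1)(2f(s) + 2f(1−s))` (Stark: `f(s) + f(1−s)`, ×`2s(s−1)`; Lagarias–Suzuki's `2H(y,s)/(2s−1)`).
[cite: Stark1967EpsteinZeros, §3 Lemma 5] -/
def epsteinMain (z : ℍ) (s : ℂ) : ℂ :=
  epsteinP z s - s * (s - 1) * epsteinBesselPart z s

/-- Unfolding. [folklore] -/
theorem epsteinMain_def (z : ℍ) (s : ℂ) :
    epsteinMain z s = epsteinP z s - s * (s - 1) * epsteinBesselPart z s := rfl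

/-- `M_z` is entire (`k ≥ 1`). [folklore] -/
theorem differentiable_epsteinMain (z : ℍ) (hy : 1 ≤ z.im) : Differentiable ℂ (epsteinMain z) := by
  unfold epsteinMain
  exact (differentiable_epsteinP z).sub ((differentiable_id.mul (differentiable_id.sub_const 1)).mul
    (differentiable_epsteinBesselPart z hy))

/-- **`M_z(s) = s(s−1)(2f(s) + 2f(1−s))` off `{0, ½, 1}`** (the constant-term decomposition).
[cite: Stark1967EpsteinZeros, §2 (11)] -/
theorem epsteinMain_eq (z : ℍ) (hy : 1 ≤ z.im) {s : ℂ} (h0 : s ≠ 0) (h1 : s ≠ 1) (hh : s ≠ 1 / 2) :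
    epsteinMain z s = s * (s - 1) * (2 * starkF z s + 2 * starkF z (1 - s)) := by
  rw [epsteinMain_def, epsteinP_eq_mul_Λ z h0 h1, Λ_eq_constantTerm_add_besselPart z hy h0 h1 hh,
    starkF_def, starkF_def]
  have e : 2 * (1 - s) = 2 - 2 * s := by ring
  rw [e]
  ring

/-- Functional equation `M_z(1 − s) = M_z(s)`. [cite: Stark1967EpsteinZeros, §2 (12)–(13)] -/
theorem epsteinMain_one_sub (z : ℍ) (s : ℂ) : epsteinMain z (1 - s) = epsteinMain z s := by
  rw [epsteinMain_def, epsteinMain_def, epsteinP_one_sub, epsteinBesselPart_one_sub]; ring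

/-- `M_z(s̄) = conj M_z(s)`. [folklore] -/
theorem epsteinMain_conj (z : ℍ) (s : ℂ) : epsteinMain z (conj s) = conj (epsteinMain z s) := by
  rw [epsteinMain_def, epsteinMain_def, epsteinP_conj, epsteinBesselPart_conj]
  simp only [map_sub, map_mul, map_one]

/-- `M_z'(1 − s) = −M_z'(s)`. [folklore] -/
theorem deriv_epsteinMain_one_sub (z : ℍ) (hy : 1 ≤ z.im) (s : ℂ) :
    deriv (epsteinMain z) (1 - s) = -deriv (epsteinMain z) s := by
  have h : (epsteinMain z) = fun w ↦ epsteinMain z (1 - w) := by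
    funext w; rw [epsteinMain_one_sub]
  have hd : HasDerivAt (fun w ↦ epsteinMain z (1 - w)) (deriv (epsteinMain z) (1 - s) * (-1)) s := by
    have h1 : HasDerivAt (fun w : ℂ ↦ 1 - w) (-1) s := (hasDerivAt_id' s).const_sub 1
    exact ((differentiable_epsteinMain z hy) (1 - s)).hasDerivAt.comp s h1
  rw [← h] at hd
  rw [hd.deriv]; ring

/-- `M_z'(s̄) = conj M_z'(s)`. [folklore] -/
theorem deriv_epsteinMain_conj (z : ℍ) (s : ℂ) :
    deriv (epsteinMain z) (conj s) = conj (deriv (epsteinMain z) s) := by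
  have hfun : (conj ∘ epsteinMain z ∘ conj : ℂ → ℂ) = epsteinMain z := by
    funext w; simp [Function.comp_apply, epsteinMain_conj]
  have h : deriv (conj ∘ epsteinMain z ∘ conj : ℂ → ℂ) = conj ∘ deriv (epsteinMain z) ∘ conj :=
    deriv_conj_conj
  rw [hfun] at h
  have h' := congrFun h (conj s)
  simpa using h'

/-- `P_z − M_z = s(s−1)E_z` is small: `‖P_z(s) − M_z(s)‖ = ‖s(s−1)‖ ‖E_z(s)‖`. [folklore] -/
theorem norm_epsteinP_sub_epsteinMain (z : ℍ) (s : ℂ) :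
    ‖epsteinP z s - epsteinMain z s‖ = ‖s * (s - 1)‖ * ‖epsteinBesselPart z s‖ := by
  rw [epsteinMain_def, sub_sub_cancel, norm_mul]

/-- On the critical line `f(½ − it) = conj f(½ + it)`, so `2f(s) + 2f(1 − s) = 4 Re f(s)` there.
[cite: Stark1967EpsteinZeros, §4] -/
theorem two_mul_starkF_add_critical (z : ℍ) (t : ℝ) :
    2 * starkF z (1 / 2 + t * I) + 2 * starkF z (1 - (1 / 2 + t * I)) =
      ((4 * (starkF z (1 / 2 + t * I)).re : ℝ) : ℂ) := by
  have e : 1 - (1 / 2 + (t : ℂ) * I) = conj (1 / 2 + t * I) := by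
    apply Complex.ext <;> simp; norm_num
  rw [e, starkF_conj]
  apply Complex.ext <;> simp; ring

end Literature.Barriers.RiemannHypothesis
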